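import Mathlib
import Literature.Analysis.FluidPDE.Tao2016AveragedNS.ShiftSetCascadeFlows
import Literature.Analysis.FluidPDE.Tao2016AveragedNS.ShiftSetCascadeFlux
import Summits.NavierStokesRegularity.NavierStokesRegularity.Theorems.TaoLadderRungTwoFlatMirrorField
import Summits.NavierStokesRegularity.NavierStokesRegularity.Theorems.TaoLadderRungTwoFlatHomogeneousL2Field
import Summits.NavierStokesRegularity.NavierStokesRegularity.Theorems.TaoLadderRungTwoFlatDatumExistence
import Summits.NavierStokesRegularity.NavierStokesRegularity.Theorems.TaoLadderRungTwoFlatDatumUniqueness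
import Summits.NavierStokesRegularity.NavierStokesRegularity.Theorems.TaoLadderRungTwoFlatTailEnergy
import HarnessLib

/-!
# The datum solution as an `ℓ²` trajectory, and its ENERGY LIGHT CONE
  (helper for item stmt-NavierStokesRegularity-22987 `FlatGapCertificatesV2`, crux K_A♭ of route TaoLadderRungTwoFlat;
  cell harvest/h2-tao-ladder, p1 g20)

By uniqueness (`…DatumUniqueness.isDatumSol_unique`) THE datum solution of `T♭(ε)` from the one-shell datum `X₀` is the
coordinate family of the `ℓ²`-valued solution `W` from `datumState X₀` (`…DatumExistence.exists_l2Solution`):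
`IsDatumSol.exists_l2`. Hence every `ℓ²`-level statement transfers to `IsDatumSol`; in particular the energy light cone
of `…TailEnergy` (bond-flux table size `C_b(T♭(ε)) = 1 + |ε|`, `…MirrorField.coeffAbsOn_botShifts_mirrorTable`):

* `IsDatumSol.tsum_sq_ge_le` — **for `t ≥ 0` and every `j : ℕ`, the energy of the datum solution on the shells `k ≥ j`
  satisfies `Σ_{k ≥ j} Σᵢ X_{i,k}(t)² ≤ E₀·(8(1+|ε|)‖X₀‖·t)^j/j!`**, `E₀ = Σᵢ X₀ᵢ² = ‖X₀‖²`: at λ₀ = 1 the energy front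
  of the datum solution advances at most linearly (speed `≲ 8e(1+|ε|)‖X₀‖` shells per unit time), with factorially
  small leakage beyond.

HONEST FRAMING: elementary consequences for a MODEL lattice; nothing certified; nothing about the Navier–Stokes equations.
-/

noncomputable section

-- the sub-problem namespace repeats the summit name by design (D-0017)
set_option linter.dupNamespace false

namespace Summit.NavierStokesRegularity.NavierStokesRegularity.Theorems

open Set Filter Metric Literature.Analysis.FluidPDE Literature.Analysis.FluidPDE.TaoCascade
open scoped Topology NNReal ENNReal Nat

namespace MirrorPulse

open QuadPolar

/-- **The datum solution is the `ℓ²` trajectory from the datum state**: there is `W : ℝ → ℓ²(ℤ; ℝ²)` with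
`W 0 = datumState X₀`, solving `Ẇ = Q(W)` at every time, with `‖W t‖ = ‖X₀‖`, whose coordinates ARE the datum solution.
[cite: Tao2016AveragedNS, §4 Lemma 4.1 (statement shape); route TaoLadderRungTwoFlat, λ₀ = 1 layer] -/
theorem IsDatumSol.exists_l2 {ε : ℝ} {X₀ : Fin 2 → ℝ} {X : Fin 2 → ℤ → ℝ → ℝ} (hX : IsDatumSol ε X₀ X) :
    ∃ W : ℝ → lp (fun _ : ℤ => EuclideanSpace ℝ (Fin 2)) 2, W 0 = datumState X₀ ∧
      (∀ t, HasDerivAt W (l2Field isNearestNeighbourSet_shiftSetFlat (mirrorTable ε ε) (W t)) t) ∧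
      (∀ t, ‖W t‖ = ‖datumState X₀‖) ∧ ∀ i k t, X i k t = (W t : ∀ _ : ℤ, EuclideanSpace ℝ (Fin 2)) k i := by
  obtain ⟨W, hW0, hWd, hWn⟩ := exists_l2Solution isNearestNeighbourSet_shiftSetFlat isSlotClosed_shiftSetFlat
    (isCancellingCoeffOn_mirrorTable ε ε) (datumState X₀)
  refine ⟨W, hW0, hWd, hWn, ?_⟩
  -- the coordinates of W form a datum solution
  set Y : Fin 2 → ℤ → ℝ → ℝ := fun i k t => (W t : ∀ _ : ℤ, EuclideanSpace ℝ (Fin 2)) k i with hY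
  have hYsol : IsDatumSol ε X₀ Y := by
    refine ⟨fun i n t => ?_, fun i n => ?_, fun T => ⟨‖datumState X₀‖, fun i n t _ => ?_⟩⟩
    · have h0 := (((EuclideanSpace.proj i).comp (shellCLM 2 n)).hasFDerivAt).comp_hasDerivAt t (hWd t)
      have h1 : HasDerivAt (fun s => (W s : ∀ _ : ℤ, EuclideanSpace ℝ (Fin 2)) n i)
          ((l2Field isNearestNeighbourSet_shiftSetFlat (mirrorTable ε ε) (W t) :
            ∀ _ : ℤ, EuclideanSpace ℝ (Fin 2)) n i) t := by
        simpa [Function.comp_def, shellCLM_apply] using h0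
      rw [l2Field_apply] at h1
      exact h1
    · show (W 0 : ∀ _ : ℤ, EuclideanSpace ℝ (Fin 2)) n i = _
      rw [hW0, datumState_apply]
    · calc |(W t : ∀ _ : ℤ, EuclideanSpace ℝ (Fin 2)) n i| ≤ ‖(W t : ∀ _ : ℤ, EuclideanSpace ℝ (Fin 2)) n‖ :=
            abs_apply_le_norm _ i
        _ ≤ ‖W t‖ := lp.norm_apply_le_norm (by norm_num) (W t) n
        _ = ‖datumState X₀‖ := hWn t
  intro i k t
  rw [isDatumSol_unique hX hYsol]

/-- **ENERGY LIGHT CONE OF THE DATUM SOLUTION** (λ₀ = 1): for `t ≥ 0` and `j : ℕ`, the energy on the shells `k ≥ j` is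
at most `E₀·(8(1+|ε|)‖X₀‖t)^j/j!`, `E₀ = Σᵢ X₀ᵢ²`, `‖X₀‖ = √E₀`.
[cite: Tao2016AveragedNS, §4 Lemma 4.1 (4.5) (a priori decay, statement shape) and proof of (v); route TaoLadderRungTwoFlat, λ₀ = 1 layer] -/
theorem IsDatumSol.tsum_sq_ge_le {ε : ℝ} {X₀ : Fin 2 → ℝ} {X : Fin 2 → ℤ → ℝ → ℝ} (hX : IsDatumSol ε X₀ X)
    (j : ℕ) {t : ℝ} (ht : 0 ≤ t) :
    ∑' k : ℤ, (if (j : ℤ) ≤ k then ∑ i, X i k t ^ 2 else 0) ≤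
      (∑ i, X₀ i ^ 2) * (8 * (1 + |ε|) * Real.sqrt (∑ i, X₀ i ^ 2) * t) ^ j / j ! := by
  obtain ⟨W, hW0, hWd, hWn, hXW⟩ := hX.exists_l2
  have hsupp : ∀ k, (0 : ℤ) < k → (W 0 : ∀ _ : ℤ, EuclideanSpace ℝ (Fin 2)) k = 0 := by
    intro k hk
    rw [hW0, datumState, lp.single_apply, Pi.single_apply, if_neg (by omega)]
  have hR : ∀ s, 0 ≤ s → ‖W s‖ ≤ ‖datumState X₀‖ := fun s _ => (hWn s).le
  have h := tailEnergy_le_pow_div_factorial isNearestNeighbourSet_shiftSetFlat isSlotClosed_shiftSetFlat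
    (isCancellingCoeffOn_mirrorTable ε ε) hWd hR hsupp j t ht
  rw [MirrorField.coeffAbsOn_botShifts_mirrorTable] at h
  have hE : ‖datumState X₀‖ ^ 2 = ∑ i, X₀ i ^ 2 := norm_datumState_sq X₀
  have hnorm : ‖datumState X₀‖ = Real.sqrt (∑ i, X₀ i ^ 2) := by rw [← hE, Real.sqrt_sq (norm_nonneg _)]
  -- the left side: the tail energy beyond shell j - 1
  have htail := hasSum_norm_sq_tailProj ((0 : ℤ) - 1 + j) (W t)
  have hlhs : ∑' k : ℤ, (if (j : ℤ) ≤ k then ∑ i, X i k t ^ 2 else 0) = ‖tailProj 2 ((0 : ℤ) - 1 + j) (W t)‖ ^ 2 := by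
    rw [← htail.tsum_eq]
    refine tsum_congr fun k => ?_
    by_cases hk : (j : ℤ) ≤ k
    · rw [if_pos hk, if_pos (by omega), norm_sq_eq_sum_sq]
      exact Finset.sum_congr rfl fun i _ => by rw [hXW i k t]
    · rw [if_neg hk, if_neg (by omega)]
  rw [hlhs, ← hnorm, ← hE]
  exact h

end MirrorPulse

end Summit.NavierStokesRegularity.NavierStokesRegularity.Theorems

end
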